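import Summits.Ventures.YMGap.RobustBall.BoundaryStateMarginal
import HarnessLib

/-!
# Venture YMGap, track ROBUST-BALL — «C-SUPP»: EVERY DLR STATE OF LATTICE YANG–MILLS IS LOCALLY EQUIVALENT TO PRODUCT HAAR WITH TWO-SIDED
# DENSITY BOUNDS `e^{±2|b|·sup|S_Λ|}` (finite energy / full support of every finite-dimensional marginal)

HONEST FRAMING. WHAT THIS IS: a venture file (cell `pub-ymgap`, track Y2 ROBUST-BALL / DS, seat ds-3, theorems only, 0 compute), a structural
corollary of «C-ENT-μ»'s mixture theorem `BoundaryStateMarginal.map_restrict_eq_withDensity`. GENERIC (every compact metrisable `G`, continuous `ρ`,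
every `d`, every real coupling `b`, EVERY DLR state `μ` of the Wilson specification, every finite link volume `Λ`, `C` any bound of `|S_Λ|`):
* ★★ `smul_pi_haar_le_map_restrict` / `map_restrict_le_smul_pi_haar` — `e^{−2|b|C}·Haar_Λ ≤ μ|_Λ ≤ e^{2|b|C}·Haar_Λ` as measures on the inner links:
  every finite-dimensional marginal of EVERY DLR state (at ANY coupling, no window) is equivalent to product Haar with explicit two-sided density
  bounds — in particular it charges every Haar-non-null (e.g. nonempty open) cylinder event (`map_restrict_pos_of_pi_haar_pos`);
* `SU(N)`: `suN_abs_wilsonBoundaryAction_le` (`|S_Λ| ≤ 2N·#T(Λ)`) and ★★ `suN_map_restrict_density_bounds` — the bounds `e^{±4N|β|·#T(Λ)}` for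
  `SU(N)` lattice Yang–Mills at tree coupling `β`, every `N`, `d`, `β`, every DLR state.
WHAT THIS IS NOT: volume-dependent constants (this is NOT a statement about the thermodynamic limit); lattice; nothing continuum / Clay.
Everything here is proved. [folklore]
-/

noncomputable section

open MeasureTheory ProbabilityTheory Real Finset Set
open scoped NNReal ENNReal
open Literature.Probability.LatticeModels hiding configShift configShift_apply
open Literature.MathematicalPhysics.QuantumLattice
open Literature.MathematicalPhysics.QuantumFieldTheory (haarProbability)

namespace Summit.Ventures.YMGap.RobustBall

namespace BoundaryFreeEnergy

section Generic

variable {d N : ℕ} {G : Type*} [Group G] [TopologicalSpace G] [IsTopologicalGroup G] [CompactSpace G]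
  [MeasurableSpace G] [BorelSpace G] [SecondCountableTopology G] (ρ : G →* Matrix (Fin N) (Fin N) ℂ)

/-- ★★ **LOWER DENSITY BOUND**: `e^{−2|b|C}·Haar_Λ ≤ μ|_Λ` for every DLR state `μ` at coupling `b`, every finite `Λ` and every bound `C` of `|S_Λ|`.
[folklore] -/
theorem smul_pi_haar_le_map_restrict (hρ : Continuous ρ) (b : ℝ) (Λ : Finset (ZdEdge d)) {μ : Measure (LGConfig d G)}
    (hμ : μ ∈ ymGibbsMeasures ρ b) {C : ℝ} (hC : ∀ U : LGConfig d G, |wilsonBoundaryAction ρ Λ U| ≤ C) :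
    ENNReal.ofReal (Real.exp (-(2 * |b| * C))) • (Measure.pi fun _ : ↥Λ => haarProbability G) ≤ μ.map (fun U (e : ↥Λ) => U e) := by
  have hGibbs : IsGibbsMeasure (ymSpecification ρ b) μ := hμ
  haveI := hGibbs.isProbabilityMeasure
  rw [map_restrict_eq_withDensity ρ hρ b Λ hμ]
  set H : Measure (↥Λ → G) := Measure.pi fun _ : ↥Λ => haarProbability G with hH
  have hpb := fun η ζ => innerDensity_mem_Icc ρ hρ b Λ hC η ζ
  have hlo : ∀ ζ : ↥Λ → G, Real.exp (-(2 * |b| * C)) ≤ ∫ η, Real.exp (-b * wilsonBoundaryAction ρ Λ (glueWith Λ ζ η)) /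
      ∫ ζ', Real.exp (-b * wilsonBoundaryAction ρ Λ (glueWith Λ ζ' η)) ∂H ∂μ := fun ζ => by
    have hpm := measurable_innerDensity ρ hρ b Λ
    have hint : Integrable (fun η => Real.exp (-b * wilsonBoundaryAction ρ Λ (glueWith Λ ζ η)) /
        ∫ ζ', Real.exp (-b * wilsonBoundaryAction ρ Λ (glueWith Λ ζ' η)) ∂H) μ :=
      Integrable.of_bound (hpm.comp (measurable_id.prodMk measurable_const)).aestronglyMeasurable (Real.exp (2 * |b| * C))
        (ae_of_all _ fun η => by
          rw [Real.norm_eq_abs, abs_of_nonneg ((Real.exp_nonneg _).trans (hpb η ζ).1)]; exact (hpb η ζ).2)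
    have h := integral_mono (integrable_const (Real.exp (-(2 * |b| * C)))) hint fun η => (hpb η ζ).1
    simpa using h
  calc ENNReal.ofReal (Real.exp (-(2 * |b| * C))) • H = H.withDensity fun _ => ENNReal.ofReal (Real.exp (-(2 * |b| * C))) := by
        rw [withDensity_const]
    _ ≤ _ := withDensity_mono (ae_of_all _ fun ζ => ENNReal.ofReal_le_ofReal (hlo ζ))

/-- ★★ **UPPER DENSITY BOUND**: `μ|_Λ ≤ e^{2|b|C}·Haar_Λ`. [folklore] -/
theorem map_restrict_le_smul_pi_haar (hρ : Continuous ρ) (b : ℝ) (Λ : Finset (ZdEdge d)) {μ : Measure (LGConfig d G)}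
    (hμ : μ ∈ ymGibbsMeasures ρ b) {C : ℝ} (hC : ∀ U : LGConfig d G, |wilsonBoundaryAction ρ Λ U| ≤ C) :
    μ.map (fun U (e : ↥Λ) => U e) ≤ ENNReal.ofReal (Real.exp (2 * |b| * C)) • (Measure.pi fun _ : ↥Λ => haarProbability G) := by
  have hGibbs : IsGibbsMeasure (ymSpecification ρ b) μ := hμ
  haveI := hGibbs.isProbabilityMeasure
  rw [map_restrict_eq_withDensity ρ hρ b Λ hμ]
  set H : Measure (↥Λ → G) := Measure.pi fun _ : ↥Λ => haarProbability G with hH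
  haveI : IsProbabilityMeasure H := by rw [hH]; infer_instance
  have hpb := fun η ζ => innerDensity_mem_Icc ρ hρ b Λ hC η ζ
  have hhi : ∀ ζ : ↥Λ → G, ∫ η, Real.exp (-b * wilsonBoundaryAction ρ Λ (glueWith Λ ζ η)) /
      ∫ ζ', Real.exp (-b * wilsonBoundaryAction ρ Λ (glueWith Λ ζ' η)) ∂H ∂μ ≤ Real.exp (2 * |b| * C) := fun ζ => by
    have hpm := measurable_innerDensity ρ hρ b Λ
    have hint : Integrable (fun η => Real.exp (-b * wilsonBoundaryAction ρ Λ (glueWith Λ ζ η)) /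
        ∫ ζ', Real.exp (-b * wilsonBoundaryAction ρ Λ (glueWith Λ ζ' η)) ∂H) μ :=
      Integrable.of_bound (hpm.comp (measurable_id.prodMk measurable_const)).aestronglyMeasurable (Real.exp (2 * |b| * C))
        (ae_of_all _ fun η => by
          rw [Real.norm_eq_abs, abs_of_nonneg ((Real.exp_nonneg _).trans (hpb η ζ).1)]; exact (hpb η ζ).2)
    have h := integral_mono hint (integrable_const (Real.exp (2 * |b| * C))) fun η => (hpb η ζ).2
    simpa using h
  calc H.withDensity _ ≤ H.withDensity fun _ => ENNReal.ofReal (Real.exp (2 * |b| * C)) :=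
        withDensity_mono (ae_of_all _ fun ζ => ENNReal.ofReal_le_ofReal (hhi ζ))
    _ = ENNReal.ofReal (Real.exp (2 * |b| * C)) • H := by rw [withDensity_const]

/-- **Full support**: every Haar-non-null event of the inner links has positive probability under EVERY DLR state (finite energy). [folklore] -/
theorem map_restrict_pos_of_pi_haar_pos (hρ : Continuous ρ) (b : ℝ) (Λ : Finset (ZdEdge d)) {μ : Measure (LGConfig d G)}
    (hμ : μ ∈ ymGibbsMeasures ρ b) {A : Set (↥Λ → G)} (hA : 0 < (Measure.pi fun _ : ↥Λ => haarProbability G) A) :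
    0 < μ.map (fun U (e : ↥Λ) => U e) A := by
  obtain ⟨C, hC⟩ := exists_bound_of_continuous (continuous_wilsonBoundaryAction (G := G) ρ hρ Λ)
  have h := smul_pi_haar_le_map_restrict ρ hρ b Λ hμ hC
  have h1 : ENNReal.ofReal (Real.exp (-(2 * |b| * C))) * (Measure.pi fun _ : ↥Λ => haarProbability G) A ≤
      μ.map (fun U (e : ↥Λ) => U e) A := by
    have := h A
    simpa [Measure.smul_apply, smul_eq_mul] using this
  refine lt_of_lt_of_le ?_ h1
  exact ENNReal.mul_pos (ENNReal.ofReal_pos.2 (Real.exp_pos _)).ne' hA.ne'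

end Generic

/-! ### `SU(N)`: explicit constants -/

section SUN

variable {d N : ℕ}

/-- `|S_Λ(U)| ≤ 2N·#T(Λ)` for `SU(N)` (each plaquette term `N − Re tr U_p ∈ [0, 2N]`). [folklore] -/
theorem suN_abs_wilsonBoundaryAction_le (Λ : Finset (ZdEdge d)) (U : LGConfig d (SUN N)) :
    |wilsonBoundaryAction (fundamentalRep (Fin N)) Λ U| ≤ 2 * N * (plaquettesTouching Λ).card := by
  unfold wilsonBoundaryAction
  refine (Finset.abs_sum_le_sum_abs _ _).trans ?_
  refine (Finset.sum_le_card_nsmul _ _ (2 * (N : ℝ)) fun p _ => ?_).trans (by rw [nsmul_eq_mul]; ring_nf; rfl)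
  have h := abs_plaquetteObs_le_holds (fundamentalRep (Fin N)) fundamentalRep_mem_unitaryGroup p.1 p.2.1.1 p.2.1.2 U
  rw [abs_le] at h ⊢
  constructor <;> linarith [h.1, h.2]

/-- ★★ **`SU(N)` LATTICE YANG–MILLS, EVERY `N`, `d`, EVERY REAL COUPLING `β`, EVERY DLR STATE `μ`**: on every finite link volume `Λ`,
`e^{−4N|β|·#T(Λ)}·Haar_Λ ≤ μ|_Λ ≤ e^{4N|β|·#T(Λ)}·Haar_Λ` — every finite-dimensional marginal is equivalent to product Haar with explicit two-sided
density bounds (finite energy, full support). [folklore] -/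
theorem suN_map_restrict_density_bounds (β : ℝ) (Λ : Finset (ZdEdge d)) {μ : Measure (LGConfig d (SUN N))}
    (hμ : μ ∈ ymGibbsMeasures (d := d) (fundamentalRep (Fin N)) β) :
    ENNReal.ofReal (Real.exp (-(4 * N * |β| * (plaquettesTouching Λ).card))) • (Measure.pi fun _ : ↥Λ => haarProbability (SUN N)) ≤
        μ.map (fun U (e : ↥Λ) => U e) ∧
      μ.map (fun U (e : ↥Λ) => U e) ≤
        ENNReal.ofReal (Real.exp (4 * N * |β| * (plaquettesTouching Λ).card)) • (Measure.pi fun _ : ↥Λ => haarProbability (SUN N)) := by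
  haveI : SecondCountableTopology (Matrix.specialUnitaryGroup (Fin N) ℂ) :=
    haveI : SecondCountableTopology (Matrix (Fin N) (Fin N) ℂ) := inferInstanceAs (SecondCountableTopology (Fin N → Fin N → ℂ))
    Topology.IsEmbedding.subtypeVal.secondCountableTopology
  have hρc : Continuous (fundamentalRep (Fin N)) := continuous_fundamentalRep (Fin N)
  have hC := suN_abs_wilsonBoundaryAction_le (N := N) Λ
  have e : 2 * |β| * (2 * N * ((plaquettesTouching Λ).card : ℝ)) = 4 * N * |β| * (plaquettesTouching Λ).card := by ring
  constructor
  · have h := smul_pi_haar_le_map_restrict (fundamentalRep (Fin N)) hρc β Λ hμ hC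
    rwa [e] at h
  · have h := map_restrict_le_smul_pi_haar (fundamentalRep (Fin N)) hρc β Λ hμ hC
    rwa [e] at h

end SUN

end BoundaryFreeEnergy

end Summit.Ventures.YMGap.RobustBall

end
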